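import Mathlib.LinearAlgebra.TensorProduct.Basis
import Mathlib.LinearAlgebra.LinearIndependent.Defs
import Mathlib.Algebra.BigOperators.Fin
import HarnessLib

/-!
# COR-CM model layer (row M22 `Fact_algDuality`, clause (ii) input): the Rosati tensor identity
# `Σ_a ι(x) b_a ⊗ y_a = Σ_a b_a ⊗ ι(x̄) y_a` from the balance of the polar family

Cell `pub-hodgecm2` (COR-CM = stage 2 of the Hodge ladder), seat `b22` (M22 reserve).  HONEST FRAMING:
pure LINEAR ALGEBRA over a field of characteristic zero; no cohomology, no cycles, no Hodge theory.

Context.  Clause (ii) of row M22 (`Fact_algDuality`: `ā^* ∘ D ∘ a^* = N(a)⁴ · D` for the Fourier-type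
operator `D z = Σ_c tr(z ⌣ x_c) • y_c` of the corner product `P`) is reduced in
`CorCM/Model/FourierIntertwine.lean` (`map_fourierSum_map_eq_smul_of_rosati`) to the **Rosati tensor
identity** in `H¹(P, ℚ) ⊗ H¹(P, ℚ)`:

  `Σ_a ι(x) b_a ⊗ y_a = Σ_a b_a ⊗ ι(x̄) y_a`   for all `x ∈ K`,

where `b` is a basis of `V = H¹`, `y_a = Σ_{a'} E_{a a'} b_{a'}` is the POLAR FAMILY of the antisymmetric
coordinate matrix `E` of a degree-two class `θ = Σ_{a<a'} E_{a a'} b_a ⌣ b_{a'}`, and `ι : K → End V` is the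
CM action with complex conjugation `x ↦ x̄`.  This file derives the identity from the form in which the
literature seats deliver the Rosati condition (lit-deligne g5, R2: the polarization is `K`-BALANCED —
for `c ∈ 𝓞_K` with `c̄ = -c`, `(1 + ι c)^* θ = θ + (ι c)^* θ`, i.e. the mixed term
`Σ_a (ι(c) b_a ⌣ y_a + b_a ⌣ ι(c) y_a)` vanishes in `H²`):

* `eq_zero_of_comm_eq_neg_of_lift_eq_zero` — an ANTISYMMETRIC tensor `s ∈ V ⊗ V` killed by an alternating
  bilinear map `cup : V × V → W` whose values `cup(b_p, b_q)`, `p < q`, are linearly independent, is zero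
  (coordinates in the basis `b ⊗ b`);
* `map_rTensor_eq_neg_of_balanced` — hence, for an antisymmetric `t` and an endomorphism `ε`,
  `cup-image of (ε ⊗ 1 + 1 ⊗ ε) t = 0` forces `(ε ⊗ 1) t = -(1 ⊗ ε) t` (the tensor `(ε ⊗ 1 + 1 ⊗ ε) t` is again
  antisymmetric);
* `rosatiTensor_of_imaginary` — from the identity for the IMAGINARY elements of a conjugation-stable subring
  `O ⊆ K` (containing a non-zero imaginary element) to `(ι(a) ⊗ 1) t = (1 ⊗ ι(ā)) t` for ALL `a ∈ O`
  (real `r`: compare `rc` and `c` for an imaginary unit-like `c` and cancel the injective `ι(c) ⊗ 1`;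
  general `a`: `2a = (a + ā) + (a - ā)`);
* `rosatiTensor_of_fraction` — from `O` to its field of fractions `K` (cancel `ι(d) ⊗ 1`);
* `sum_tmul_rosati_of_balanced` — the packaged statement for the polar family `y` of an antisymmetric
  matrix `E` in a basis `b`: balance for imaginary integers ⇒ the Rosati tensor identity for all `x ∈ K`,
  in exactly the shape consumed by `map_fourierSum_map_eq_smul_of_rosati`.

Print shape: Shimura, *Abelian Varieties with Complex Multiplication* (1998) §6.2 Thm. 4
(`E(z, T(ξ)w) = E(T(ξ^ρ)z, w)`); Deligne, LNM 900 (1982) §4–5 (Rosati involution = complex conjugation).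
-/

noncomputable section

open scoped TensorProduct

namespace Summit.HodgeConjecture.CorCM.Model

variable {𝕜 : Type*} [Field 𝕜]
variable {V W : Type*} [AddCommGroup V] [Module 𝕜 V] [AddCommGroup W] [Module 𝕜 W]

/-! ### Antisymmetric tensors killed by an alternating map with independent values -/

section Antisymm

variable {n : ℕ} (b : Module.Basis (Fin n) 𝕜 V)

/-- The coordinates of the swapped tensor `σ(s)` in the basis `b ⊗ b` are the transposed coordinates of `s`.
[folklore] -/
theorem tensorProduct_repr_comm (s : V ⊗[𝕜] V) (p q : Fin n) :
    (b.tensorProduct b).repr (TensorProduct.comm 𝕜 V V s) (p, q) = (b.tensorProduct b).repr s (q, p) := by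
  induction s using TensorProduct.induction_on generalizing p q with
  | zero => simp only [map_zero, Finsupp.zero_apply]
  | tmul u v =>
    rw [TensorProduct.comm_tmul, Module.Basis.tensorProduct_repr_tmul_apply,
      Module.Basis.tensorProduct_repr_tmul_apply, smul_eq_mul, smul_eq_mul, mul_comm]
  | add s s' hs hs' => simp only [map_add, Finsupp.add_apply, hs, hs']

/-- A tensor is the sum of its coordinates times the basis tensors `b_p ⊗ b_q`. [folklore] -/
theorem eq_sum_repr_tmul (s : V ⊗[𝕜] V) :
    s = ∑ pq : Fin n × Fin n, (b.tensorProduct b).repr s pq • (b pq.1 ⊗ₜ[𝕜] b pq.2) := by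
  conv_lhs => rw [← (b.tensorProduct b).sum_repr s]
  refine Finset.sum_congr rfl fun pq _ => ?_
  rw [Module.Basis.tensorProduct_apply']

variable (cup : V →ₗ[𝕜] V →ₗ[𝕜] W)

/-- For an alternating bilinear map, `cup(v, u) = -cup(u, v)` (polarization of `cup(w, w) = 0`).
[folklore] -/
theorem cup_swap_eq_neg (halt : ∀ v, cup v v = 0) (u v : V) : cup v u = -cup u v := by
  have h := halt (u + v)
  simp only [map_add, LinearMap.add_apply, halt u, halt v, zero_add, add_zero] at h
  exact eq_neg_of_add_eq_zero_left h

/-- **An antisymmetric tensor killed by an alternating map with independent values is zero.**  Let `b` be a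
basis of `V`, `cup : V × V → W` bilinear and alternating with the family `cup(b_p, b_q)`, `p < q`, linearly
independent in `W`.  If `s ∈ V ⊗ V` is antisymmetric (`σ s = -s`) and `cup(s) = 0`, then `s = 0`: writing
`s = Σ C_{pq} b_p ⊗ b_q` with `C` antisymmetric, `cup(s) = 2 Σ_{p<q} C_{pq} cup(b_p, b_q)`. [folklore] -/
theorem eq_zero_of_comm_eq_neg_of_lift_eq_zero [CharZero 𝕜] (halt : ∀ v, cup v v = 0)
    (hLI : LinearIndependent 𝕜 fun pq : {pq : Fin n × Fin n // pq.1 < pq.2} => cup (b pq.1.1) (b pq.1.2))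
    (s : V ⊗[𝕜] V) (hanti : TensorProduct.comm 𝕜 V V s = -s) (hcup : TensorProduct.lift cup s = 0) :
    s = 0 := by
  classical
  set C := (b.tensorProduct b).repr s with hCdef
  -- antisymmetry of the coordinates
  have hC : ∀ p q, C (q, p) = -C (p, q) := fun p q => by
    have h := tensorProduct_repr_comm b s p q
    simp only [hanti, map_neg, Finsupp.coe_neg, Pi.neg_apply] at h
    exact h.symm
  have hdiag : ∀ p, C (p, p) = 0 := fun p => by
    have h2 : (2 : 𝕜) * C (p, p) = 0 := by rw [two_mul]; nth_rw 1 [hC p p]; exact neg_add_cancel _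
    exact (mul_eq_zero.1 h2).resolve_left two_ne_zero
  -- `cup(s)` as a coordinate sum
  let f : Fin n × Fin n → W := fun pq => C pq • cup (b pq.1) (b pq.2)
  have hf_swap : ∀ p q, f (q, p) = f (p, q) := fun p q => by
    simp only [f]
    rw [hC p q, cup_swap_eq_neg cup halt (b p) (b q), smul_neg, neg_smul, neg_neg]
  have hf_diag : ∀ p, f (p, p) = 0 := fun p => by
    simp only [f]
    rw [halt, smul_zero]
  have hsum : TensorProduct.lift cup s = ∑ pq : Fin n × Fin n, f pq := by
    conv_lhs => rw [eq_sum_repr_tmul b s]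
    simp only [map_sum, map_smul, TensorProduct.lift.tmul, f, hCdef]
  -- split the square into `p < q`, `p = q`, `q < p`
  have hsplit : ∑ pq : Fin n × Fin n, f pq =
      (2 : 𝕜) • ∑ pq ∈ Finset.univ.filter (fun pq : Fin n × Fin n => pq.1 < pq.2), f pq := by
    rw [← Finset.sum_filter_add_sum_filter_not Finset.univ (fun pq : Fin n × Fin n => pq.1 < pq.2)]
    have hnot : ∑ pq ∈ Finset.univ.filter (fun pq : Fin n × Fin n => ¬pq.1 < pq.2), f pq =
        ∑ pq ∈ Finset.univ.filter (fun pq : Fin n × Fin n => pq.2 < pq.1), f pq +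
          ∑ pq ∈ Finset.univ.filter (fun pq : Fin n × Fin n => pq.1 = pq.2), f pq := by
      rw [← Finset.sum_union]
      · refine Finset.sum_congr ?_ fun _ _ => rfl
        ext pq
        simp only [Finset.mem_filter, Finset.mem_univ, true_and, Finset.mem_union, not_lt]
        exact ⟨fun h => (lt_or_eq_of_le h).imp id Eq.symm, fun h => h.elim le_of_lt fun h => le_of_eq h.symm⟩
      · rw [Finset.disjoint_filter]
        intro pq _ h1 h2
        rw [h2] at h1
        exact lt_irrefl _ h1
    have hdiag0 : ∑ pq ∈ Finset.univ.filter (fun pq : Fin n × Fin n => pq.1 = pq.2), f pq = 0 := by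
      refine Finset.sum_eq_zero fun pq hpq => ?_
      obtain ⟨p, q⟩ := pq
      obtain ⟨-, hpq⟩ := Finset.mem_filter.1 hpq
      dsimp only at hpq
      rw [hpq]
      exact hf_diag q
    have hgt : ∑ pq ∈ Finset.univ.filter (fun pq : Fin n × Fin n => pq.2 < pq.1), f pq =
        ∑ pq ∈ Finset.univ.filter (fun pq : Fin n × Fin n => pq.1 < pq.2), f pq := by
      refine Finset.sum_equiv (Equiv.prodComm (Fin n) (Fin n)) (fun pq => ?_) (fun pq _ => ?_)
      · simp only [Finset.mem_filter, Finset.mem_univ, true_and, Equiv.prodComm_apply, Prod.fst_swap,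
          Prod.snd_swap]
      · obtain ⟨p, q⟩ := pq
        rw [Equiv.prodComm_apply, Prod.swap_prod_mk]
        exact hf_swap q p
    rw [hnot, hdiag0, add_zero, hgt, two_smul]
  -- the `p < q` part vanishes, hence every coordinate with `p < q` vanishes
  have hlt0 : ∑ pq ∈ Finset.univ.filter (fun pq : Fin n × Fin n => pq.1 < pq.2), f pq = 0 := by
    have h : (2 : 𝕜) • ∑ pq ∈ Finset.univ.filter (fun pq : Fin n × Fin n => pq.1 < pq.2), f pq = 0 := by
      rw [← hsplit, ← hsum, hcup]
    exact (smul_eq_zero.1 h).resolve_left two_ne_zero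
  have hsub : ∑ pq : {pq : Fin n × Fin n // pq.1 < pq.2}, C pq.1 • cup (b pq.1.1) (b pq.1.2) = 0 := by
    rw [← hlt0, Finset.sum_subtype (Finset.univ.filter (fun pq : Fin n × Fin n => pq.1 < pq.2))
      (p := fun pq : Fin n × Fin n => pq.1 < pq.2)]
    intro pq
    simp only [Finset.mem_filter, Finset.mem_univ, true_and]
  have hClt : ∀ pq : {pq : Fin n × Fin n // pq.1 < pq.2}, C pq.1 = 0 :=
    Fintype.linearIndependent_iff.1 hLI (fun pq => C pq.1) hsub
  -- all coordinates vanish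
  have hC0 : ∀ pq : Fin n × Fin n, C pq = 0 := by
    rintro ⟨p, q⟩
    rcases lt_trichotomy p q with h | h | h
    · exact hClt ⟨(p, q), h⟩
    · subst h; exact hdiag p
    · rw [hC q p, hClt ⟨(q, p), h⟩, neg_zero]
  have : C = 0 := Finsupp.ext hC0
  rw [hCdef, LinearEquiv.map_eq_zero_iff] at this
  exact this

/-- Naturality of the swap: `σ ∘ (f ⊗ g) = (g ⊗ f) ∘ σ`. [folklore] -/
theorem comm_map_apply (f g : V →ₗ[𝕜] V) (x : V ⊗[𝕜] V) :
    TensorProduct.comm 𝕜 V V (TensorProduct.map f g x) =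
      TensorProduct.map g f (TensorProduct.comm 𝕜 V V x) := by
  induction x using TensorProduct.induction_on with
  | zero => simp only [map_zero]
  | tmul u v => rw [TensorProduct.map_tmul, TensorProduct.comm_tmul, TensorProduct.comm_tmul,
      TensorProduct.map_tmul]
  | add x x' hx hx' => simp only [map_add, hx, hx']

/-- **Balance forces the tensor identity.**  For an antisymmetric tensor `t ∈ V ⊗ V` and an endomorphism
`ε` of `V`: if the alternating map `cup` (with independent values on `b_p, b_q`, `p < q`) kills
`(ε ⊗ 1) t + (1 ⊗ ε) t`, then `(ε ⊗ 1) t = -(1 ⊗ ε) t`.  (The tensor `(ε ⊗ 1 + 1 ⊗ ε) t` is antisymmetric,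
so `eq_zero_of_comm_eq_neg_of_lift_eq_zero` applies.)  On the model: `t = Σ_a b_a ⊗ y_a` is the polar tensor
of a polarization `θ`, `ε = ι(c)` for an imaginary `c ∈ 𝓞_K`, and the hypothesis is the `K`-balance of
`θ` ("`(1 + ι c)^* θ = θ + (ι c)^* θ`"). [folklore] -/
theorem map_rTensor_eq_neg_of_balanced [CharZero 𝕜] (halt : ∀ v, cup v v = 0)
    (hLI : LinearIndependent 𝕜 fun pq : {pq : Fin n × Fin n // pq.1 < pq.2} => cup (b pq.1.1) (b pq.1.2))
    (t : V ⊗[𝕜] V) (hanti : TensorProduct.comm 𝕜 V V t = -t) (ε : V →ₗ[𝕜] V)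
    (hbal : TensorProduct.lift cup
      (TensorProduct.map ε LinearMap.id t + TensorProduct.map LinearMap.id ε t) = 0) :
    TensorProduct.map ε LinearMap.id t = -TensorProduct.map LinearMap.id ε t := by
  refine eq_neg_of_add_eq_zero_left
    (eq_zero_of_comm_eq_neg_of_lift_eq_zero b cup halt hLI _ ?_ hbal)
  rw [map_add, comm_map_apply, comm_map_apply, hanti, map_neg, map_neg]
  abel

end Antisymm

/-! ### From imaginary integers to the whole field -/

section Field

variable {K : Type*} [Field K] (ι : K →+* Module.End 𝕜 V) (σ : K →+* K)

/-- `ι(d) ⊗ 1` is injective for `d ≠ 0` (its inverse is `ι(d⁻¹) ⊗ 1`). [folklore] -/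
theorem map_rTensor_injective {d : K} (hd : d ≠ 0) :
    Function.Injective (TensorProduct.map (ι d) (LinearMap.id : V →ₗ[𝕜] V)) := by
  refine Function.LeftInverse.injective (g := TensorProduct.map (ι d⁻¹) (LinearMap.id : V →ₗ[𝕜] V)) ?_
  intro x
  rw [← LinearMap.comp_apply, ← TensorProduct.map_comp, ← Module.End.mul_eq_comp, ← map_mul,
    inv_mul_cancel₀ hd, map_one, LinearMap.comp_id, Module.End.one_eq_id, TensorProduct.map_id,
    LinearMap.id_apply]

/-- `(ι(a) ⊗ 1) ∘ (ι(c) ⊗ 1) = ι(ac) ⊗ 1`. [folklore] -/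
theorem map_rTensor_mul (a c : K) (x : V ⊗[𝕜] V) :
    TensorProduct.map (ι a) (LinearMap.id : V →ₗ[𝕜] V) (TensorProduct.map (ι c) LinearMap.id x) =
      TensorProduct.map (ι (a * c)) LinearMap.id x := by
  rw [← LinearMap.comp_apply, ← TensorProduct.map_comp, LinearMap.comp_id, map_mul, Module.End.mul_eq_comp]

/-- `(1 ⊗ ι(a)) ∘ (1 ⊗ ι(c)) = 1 ⊗ ι(ac)`. [folklore] -/
theorem map_lTensor_mul (a c : K) (x : V ⊗[𝕜] V) :
    TensorProduct.map (LinearMap.id : V →ₗ[𝕜] V) (ι a) (TensorProduct.map LinearMap.id (ι c) x) =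
      TensorProduct.map LinearMap.id (ι (a * c)) x := by
  rw [← LinearMap.comp_apply, ← TensorProduct.map_comp, LinearMap.comp_id, map_mul, Module.End.mul_eq_comp]

/-- `(ι(a) ⊗ 1)` and `(1 ⊗ ι(c))` commute. [folklore] -/
theorem map_rTensor_lTensor_comm (a c : K) (x : V ⊗[𝕜] V) :
    TensorProduct.map (ι a) (LinearMap.id : V →ₗ[𝕜] V) (TensorProduct.map LinearMap.id (ι c) x) =
      TensorProduct.map LinearMap.id (ι c) (TensorProduct.map (ι a) LinearMap.id x) := by
  rw [← LinearMap.comp_apply, ← TensorProduct.map_comp, ← LinearMap.comp_apply, ← TensorProduct.map_comp,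
    LinearMap.comp_id, LinearMap.id_comp, LinearMap.comp_id, LinearMap.id_comp]
/-- **From imaginary integers to all integers.**  Let `O ⊆ K` be a subring stable under the involution
`σ` and containing a non-zero `σ`-imaginary element, and let `t ∈ V ⊗ V` satisfy
`(ι(c) ⊗ 1) t = -(1 ⊗ ι(c)) t` for every imaginary `c ∈ O` (`σ c = -c`).  Then
`(ι(a) ⊗ 1) t = (1 ⊗ ι(σ a)) t` for every `a ∈ O`.  (Real `r`: `rc` is imaginary for an imaginary `c ≠ 0`,
and `ι(c) ⊗ 1` is injective; general `a`: `2a = (a + σa) + (a - σa)`.)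
[cite: Shimura1998, §6.2 Theorem 4] -/
theorem rosatiTensor_of_imaginary [CharZero 𝕜] (hσσ : ∀ a, σ (σ a) = a) (O : Subring K) (hσO : ∀ a ∈ O, σ a ∈ O)
    (hex : ∃ c ∈ O, c ≠ 0 ∧ σ c = -c) (t : V ⊗[𝕜] V)
    (himag : ∀ c ∈ O, σ c = -c →
      TensorProduct.map (ι c) LinearMap.id t = -TensorProduct.map LinearMap.id (ι c) t) :
    ∀ a ∈ O, TensorProduct.map (ι a) LinearMap.id t = TensorProduct.map LinearMap.id (ι (σ a)) t := by
  obtain ⟨c, hcO, hc0, hcσ⟩ := hex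
  -- real elements: compare `rc` (imaginary) with `c` and cancel `ι(c) ⊗ 1`
  have hreal : ∀ r ∈ O, σ r = r →
      TensorProduct.map (ι r) LinearMap.id t = TensorProduct.map LinearMap.id (ι r) t := by
    intro r hrO hr
    have hrc : σ (r * c) = -(r * c) := by rw [map_mul, hr, hcσ, mul_neg]
    have h1 := himag (r * c) (O.mul_mem hrO hcO) hrc
    have h2 : TensorProduct.map LinearMap.id (ι c) t = -TensorProduct.map (ι c) LinearMap.id t := by
      rw [himag c hcO hcσ, neg_neg]
    apply map_rTensor_injective ι hc0
    calc TensorProduct.map (ι c) LinearMap.id (TensorProduct.map (ι r) LinearMap.id t)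
        = TensorProduct.map (ι (r * c)) LinearMap.id t := by rw [map_rTensor_mul, mul_comm]
      _ = -TensorProduct.map LinearMap.id (ι (r * c)) t := h1
      _ = -TensorProduct.map LinearMap.id (ι r) (TensorProduct.map LinearMap.id (ι c) t) := by
          rw [map_lTensor_mul]
      _ = TensorProduct.map LinearMap.id (ι r) (TensorProduct.map (ι c) LinearMap.id t) := by
          rw [h2, map_neg, neg_neg]
      _ = TensorProduct.map (ι c) LinearMap.id (TensorProduct.map LinearMap.id (ι r) t) := by
          rw [map_rTensor_lTensor_comm]
  -- halving in the `𝕜`-vector space `V ⊗ V`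
  have cancel : ∀ u v : V ⊗[𝕜] V, u + u = v + v → u = v := by
    intro u v h
    rw [← two_smul 𝕜 u, ← two_smul 𝕜 v] at h
    have h' := congrArg (fun w => (2 : 𝕜)⁻¹ • w) h
    simpa only [smul_smul, inv_mul_cancel₀ (two_ne_zero : (2 : 𝕜) ≠ 0), one_smul] using h'
  -- general `a`: `a + a = (a + σ a) + (a - σ a)`, `a + σ a = (σ a + σ a) + (a - σ a)`
  intro a haO
  have hrO : a + σ a ∈ O := O.add_mem haO (hσO a haO)
  have hcO' : a - σ a ∈ O := O.sub_mem haO (hσO a haO)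
  have hr : σ (a + σ a) = a + σ a := by rw [map_add, hσσ, add_comm]
  have hc' : σ (a - σ a) = -(a - σ a) := by rw [map_sub, hσσ, neg_sub]
  have e1 := hreal _ hrO hr
  have e2 := himag _ hcO' hc'
  apply cancel
  calc TensorProduct.map (ι a) LinearMap.id t + TensorProduct.map (ι a) LinearMap.id t
      = TensorProduct.map (ι ((a + σ a) + (a - σ a))) LinearMap.id t := by
        rw [← LinearMap.add_apply, ← TensorProduct.map_add_left, ← map_add]
        congr 3
        ring
    _ = TensorProduct.map (ι (a + σ a)) LinearMap.id t + TensorProduct.map (ι (a - σ a)) LinearMap.id t := by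
        rw [map_add, TensorProduct.map_add_left, LinearMap.add_apply]
    _ = TensorProduct.map LinearMap.id (ι (a + σ a)) t - TensorProduct.map LinearMap.id (ι (a - σ a)) t := by
        rw [e1, e2, ← sub_eq_add_neg]
    _ = TensorProduct.map LinearMap.id (ι ((σ a + σ a) + (a - σ a))) t -
          TensorProduct.map LinearMap.id (ι (a - σ a)) t := by
        congr 4
        ring
    _ = TensorProduct.map LinearMap.id (ι (σ a)) t + TensorProduct.map LinearMap.id (ι (σ a)) t := by
        rw [map_add, map_add, TensorProduct.map_add_right, TensorProduct.map_add_right, LinearMap.add_apply,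
          LinearMap.add_apply, add_sub_cancel_right]

/-- **From a subring to its field of fractions.**  If `(ι(a) ⊗ 1) t = (1 ⊗ ι(σ a)) t` for all `a` in a subring
`O` of which every element of `K` is a fraction, then the identity holds for all `x ∈ K` (cancel the
injective `ι(d) ⊗ 1` for a denominator `d`). [folklore] -/
theorem rosatiTensor_of_fraction (O : Subring K) (t : V ⊗[𝕜] V)
    (hO : ∀ a ∈ O, TensorProduct.map (ι a) LinearMap.id t = TensorProduct.map LinearMap.id (ι (σ a)) t)
    (hfrac : ∀ x : K, ∃ a ∈ O, ∃ d ∈ O, d ≠ 0 ∧ x * d = a) (x : K) :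
    TensorProduct.map (ι x) LinearMap.id t = TensorProduct.map LinearMap.id (ι (σ x)) t := by
  obtain ⟨a, haO, d, hdO, hd0, hxd⟩ := hfrac x
  apply map_rTensor_injective ι hd0
  calc TensorProduct.map (ι d) LinearMap.id (TensorProduct.map (ι x) LinearMap.id t)
      = TensorProduct.map (ι a) LinearMap.id t := by rw [map_rTensor_mul, mul_comm, hxd]
    _ = TensorProduct.map LinearMap.id (ι (σ a)) t := hO a haO
    _ = TensorProduct.map LinearMap.id (ι (σ x)) (TensorProduct.map LinearMap.id (ι (σ d)) t) := by
        rw [map_lTensor_mul, ← map_mul, hxd]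
    _ = TensorProduct.map LinearMap.id (ι (σ x)) (TensorProduct.map (ι d) LinearMap.id t) := by
        rw [hO d hdO]
    _ = TensorProduct.map (ι d) LinearMap.id (TensorProduct.map LinearMap.id (ι (σ x)) t) := by
        rw [map_rTensor_lTensor_comm]

end Field

/-! ### The polar tensor `Σ_a b_a ⊗ y_a` of an antisymmetric matrix -/

section Polar

variable {n : ℕ} (b : Fin n → V) (E : Fin n → Fin n → 𝕜) (y : Fin n → V)

/-- The polar tensor expanded: `Σ_a b_a ⊗ y_a = Σ_{a,a'} E_{a a'} • b_a ⊗ b_{a'}`. [folklore] -/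
theorem sum_tmul_polar_eq (hy : ∀ a, y a = ∑ a', E a a' • b a') :
    ∑ a, b a ⊗ₜ[𝕜] y a = ∑ a, ∑ a', E a a' • (b a ⊗ₜ[𝕜] b a') := by
  refine Finset.sum_congr rfl fun a _ => ?_
  rw [hy a, TensorProduct.tmul_sum]
  refine Finset.sum_congr rfl fun a' _ => ?_
  rw [TensorProduct.tmul_smul]

/-- **The polar tensor of an antisymmetric matrix is antisymmetric**: `σ(Σ_a b_a ⊗ y_a) = -Σ_a b_a ⊗ y_a` for
`y_a = Σ_{a'} E_{a a'} b_{a'}`, `E_{a' a} = -E_{a a'}`. [folklore] -/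
theorem comm_sum_tmul_polar (hE : ∀ a a', E a' a = -E a a') (hy : ∀ a, y a = ∑ a', E a a' • b a') :
    TensorProduct.comm 𝕜 V V (∑ a, b a ⊗ₜ[𝕜] y a) = -∑ a, b a ⊗ₜ[𝕜] y a := by
  rw [sum_tmul_polar_eq b E y hy]
  simp only [map_sum, map_smul, TensorProduct.comm_tmul]
  rw [Finset.sum_comm, ← Finset.sum_neg_distrib]
  refine Finset.sum_congr rfl fun p _ => ?_
  rw [← Finset.sum_neg_distrib]
  refine Finset.sum_congr rfl fun q _ => ?_
  rw [hE p q, neg_smul]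

/-- `(f ⊗ 1)(Σ_a b_a ⊗ y_a) = Σ_a f b_a ⊗ y_a`. [folklore] -/
theorem map_rTensor_sum_tmul (f : V →ₗ[𝕜] V) :
    TensorProduct.map f LinearMap.id (∑ a, b a ⊗ₜ[𝕜] y a) = ∑ a, f (b a) ⊗ₜ[𝕜] y a := by
  simp only [map_sum, TensorProduct.map_tmul, LinearMap.id_apply]

/-- `(1 ⊗ f)(Σ_a b_a ⊗ y_a) = Σ_a b_a ⊗ f y_a`. [folklore] -/
theorem map_lTensor_sum_tmul (f : V →ₗ[𝕜] V) :
    TensorProduct.map LinearMap.id f (∑ a, b a ⊗ₜ[𝕜] y a) = ∑ a, b a ⊗ₜ[𝕜] f (y a) := by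
  simp only [map_sum, TensorProduct.map_tmul, LinearMap.id_apply]

/-- The `cup`-image of `(ε ⊗ 1 + 1 ⊗ ε)(Σ_a b_a ⊗ y_a)` is the MIXED TERM `Σ_a (ε b_a ⌣ y_a + b_a ⌣ ε y_a)`.
[folklore] -/
theorem lift_map_add_map_sum_tmul (cup : V →ₗ[𝕜] V →ₗ[𝕜] W) (ε : V →ₗ[𝕜] V) :
    TensorProduct.lift cup (TensorProduct.map ε LinearMap.id (∑ a, b a ⊗ₜ[𝕜] y a) +
        TensorProduct.map LinearMap.id ε (∑ a, b a ⊗ₜ[𝕜] y a)) =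
      ∑ a, (cup (ε (b a)) (y a) + cup (b a) (ε (y a))) := by
  rw [map_rTensor_sum_tmul, map_lTensor_sum_tmul, map_add, map_sum, map_sum, ← Finset.sum_add_distrib]
  refine Finset.sum_congr rfl fun a _ => ?_
  rw [TensorProduct.lift.tmul, TensorProduct.lift.tmul]

end Polar

/-! ### The packaged statement -/

/-- **Rosati tensor identity from balance.**  Let `b` be a basis of `V`, `cup : V × V → W` bilinear and
alternating with `cup(b_p, b_q)`, `p < q`, linearly independent (on the model: `V = H¹(P, ℚ)`, `cup` the cup
product, `W = H²(P, ℚ) = ⋀² H¹`), `E` an antisymmetric matrix with polar family `y_a = Σ_{a'} E_{a a'} b_{a'}`,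
`ι : K → End V` a ring action of a field with involution `σ` (`K` a CM field, `σ` complex conjugation),
`O ⊆ K` a `σ`-stable subring with a non-zero imaginary element of which `K` is the field of fractions
(`O = 𝓞_K`).  If the polarization is `K`-BALANCED — the mixed term `Σ_a (ι(c) b_a ⌣ y_a + b_a ⌣ ι(c) y_a)`
vanishes for every imaginary `c ∈ O` — then for every `x ∈ K`

  `Σ_a ι(x) b_a ⊗ y_a = Σ_a b_a ⊗ ι(σ x) y_a`  in `V ⊗ V`,

the hypothesis `hRos` of `map_fourierSum_map_eq_smul_of_rosati` (`CorCM/Model/FourierIntertwine.lean`).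
[cite: Shimura1998, §6.2 Theorem 4] -/
theorem sum_tmul_rosati_of_balanced [CharZero 𝕜] {n : ℕ} (b : Module.Basis (Fin n) 𝕜 V) (cup : V →ₗ[𝕜] V →ₗ[𝕜] W)
    (halt : ∀ v, cup v v = 0)
    (hLI : LinearIndependent 𝕜 fun pq : {pq : Fin n × Fin n // pq.1 < pq.2} => cup (b pq.1.1) (b pq.1.2))
    (E : Fin n → Fin n → 𝕜) (hE : ∀ a a', E a' a = -E a a') (y : Fin n → V)
    (hy : ∀ a, y a = ∑ a', E a a' • b a')
    {K : Type*} [Field K] (ι : K →+* Module.End 𝕜 V) (σ : K →+* K) (hσσ : ∀ a, σ (σ a) = a)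
    (O : Subring K) (hσO : ∀ a ∈ O, σ a ∈ O) (hex : ∃ c ∈ O, c ≠ 0 ∧ σ c = -c)
    (hfrac : ∀ x : K, ∃ a ∈ O, ∃ d ∈ O, d ≠ 0 ∧ x * d = a)
    (hbal : ∀ c ∈ O, σ c = -c → ∑ a, (cup (ι c (b a)) (y a) + cup (b a) (ι c (y a))) = 0) (x : K) :
    ∑ a, ι x (b a) ⊗ₜ[𝕜] y a = ∑ a, b a ⊗ₜ[𝕜] ι (σ x) (y a) := by
  rw [← map_rTensor_sum_tmul b y (ι x), ← map_lTensor_sum_tmul b y (ι (σ x))]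
  refine rosatiTensor_of_fraction ι σ O _ ?_ hfrac x
  refine rosatiTensor_of_imaginary ι σ hσσ O hσO hex _ fun c hcO hc => ?_
  refine map_rTensor_eq_neg_of_balanced b cup halt hLI _ (comm_sum_tmul_polar b E y hE hy) (ι c) ?_
  rw [lift_map_add_map_sum_tmul]
  exact hbal c hcO hc


end Summit.HodgeConjecture.CorCM.Model

end
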